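import Mathlib
import Literature.LinearAlgebra.Matrix.PermanentLaplace
import Summits.ValiantsHypothesis.ValiantsHypothesis.Theorems.ValuativeGCTValuativeFlipPencilBorderTools
import Summits.ValiantsHypothesis.ValiantsHypothesis.Theorems.ValuativeGCTValuativeFlipDegenerationStep

/-!
# Border recurrences for sparse-border pencils (crux `ValuativeGCT.ValuativeFlip`, stmt-ValiantsHypothesis-12624;
# wall-breaker k1 gen 1, pencil `HB_n` for `stub_fourRowPencilRank`)

Helper file (`--supports stmt-ValiantsHypothesis-12624`).  In the open Hessenberg four-band pencil `HB_N` the last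
column has exactly two entries above the corner (`b_{N-1} y₂` in row `N-1`, `d_{N-2} y₃` in row `N-2`) and the last
row exactly one entry left of the corner (`c_N y₀` in column `N-1`).  The two Laplace recurrences that drive the
walk combinatorics of `Cruxes/ValuativeFlip/AxisK1G1HessenbergPencil.md` §3–§4 are proved here for ANY algebra-valued
point `φ` of the generic matrix with that border sparsity (sizes written `n + 3` so that rows `N-1 = n+1`, `N-2 = n`
exist):

* `hb_lastRow_generator_two_term` — LAST-ROW cofactors (the walk recurrence by the last move):
  `(∂_{N, l} per)(φ) = φ(N-1, N) · (∂_{N-1, l} per_{N-1})(φ|) + φ(N-2, N) · (∂_{N-2, l} per_{N-1})(φ|)`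
  when the border column vanishes above row `N-2` (`Per_{N,j} = b y₂ Per⁽ᴺ⁻¹⁾_{N-1,j} + d y₃ Per⁽ᴺ⁻¹⁾_{N-2,j}`);
* `hb_secondRow_generator_two_term` — SECOND-TO-LAST-ROW cofactors (the `E0` completion):
  `(∂_{N-1, l} per)(φ) = φ(N, N) · (∂_{N-1, l} per_{N-1})(φ|) + φ(N, N-1) · φ(N-2, N) · (∂_{N-2, l} per_{N-2})(φ||)`
  when moreover the border row vanishes left of column `N-1`
  (`Per_{N-1,j} = a y₁ Per⁽ᴺ⁻¹⁾_{N-1,j} + c_N d_{N-2} y₀ y₃ Per⁽ᴺ⁻²⁾_{N-2,j}`), together with its matrix form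
  `hb_permanent_submatrix_secondRow_of_sparseBorder`.
All folklore Laplace expansions (Minc 1978 §1.2), packaged for the `c_N → 0` induction (`…DegenerationStep.lean`).
-/

set_option linter.dupNamespace false

namespace Summit.ValiantsHypothesis.ValiantsHypothesis.Theorems.ValuativeFlip

open scoped BigOperators Matrix
open MvPolynomial Literature.Computability.AlgebraicComplexity

section LastRow

variable {K A : Type*} [CommRing K] [CommRing A] [Algebra K A] {n : ℕ}

/-- **Last-row generators, two-term recurrence.**  If the last column of `φ` (size `n+3`) vanishes in the rows
`< n`, then the cofactor deleting the last row and an old column `l` is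
`φ(n+1, last) · (∂_{last, l} per_{n+2})(φ|) + φ(n, last) · (∂_{n, l} per_{n+2})(φ|)` — for `HB_N`:
`Per_{N,j} = b_{N-1} y₂ Per⁽ᴺ⁻¹⁾_{N-1,j} + d_{N-2} y₃ Per⁽ᴺ⁻¹⁾_{N-2,j}`. [Minc 1978 §1.2; folklore] -/
theorem hb_lastRow_generator_two_term (φ : Fin (n + 3) × Fin (n + 3) → A)
    (hcol : ∀ i : Fin n, φ (Fin.castSucc (Fin.castSucc (Fin.castSucc i)), Fin.last (n + 2)) = 0)
    (l : Fin (n + 2)) :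
    MvPolynomial.aeval φ (MvPolynomial.pderiv (Fin.last (n + 2), Fin.castSucc l) (perPoly (Fin (n + 3)) K)) =
      φ (Fin.castSucc (Fin.last (n + 1)), Fin.last (n + 2)) *
          MvPolynomial.aeval (fun q : Fin (n + 2) × Fin (n + 2) => φ (Fin.castSucc q.1, Fin.castSucc q.2))
            (MvPolynomial.pderiv (Fin.last (n + 1), l) (perPoly (Fin (n + 2)) K)) +
        φ (Fin.castSucc (Fin.castSucc (Fin.last n)), Fin.last (n + 2)) *
          MvPolynomial.aeval (fun q : Fin (n + 2) × Fin (n + 2) => φ (Fin.castSucc q.1, Fin.castSucc q.2))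
            (MvPolynomial.pderiv (Fin.castSucc (Fin.last n), l) (perPoly (Fin (n + 2)) K)) := by
  rw [hb_aeval_pderiv_perPoly_last_castSucc, Fin.sum_univ_castSucc, Fin.sum_univ_castSucc]
  have hzero : ∑ i : Fin n, φ (Fin.castSucc (Fin.castSucc (Fin.castSucc i)), Fin.last (n + 2)) *
      MvPolynomial.aeval (fun q : Fin (n + 2) × Fin (n + 2) => φ (Fin.castSucc q.1, Fin.castSucc q.2))
        (MvPolynomial.pderiv (Fin.castSucc (Fin.castSucc i), l) (perPoly (Fin (n + 2)) K)) = 0 :=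
    Finset.sum_eq_zero fun i _ => by rw [hcol i, zero_mul]
  rw [hzero, zero_add, add_comm]

end LastRow

section SecondRow

/-- Index bookkeeping: skipping an old-old index `castSucc (castSucc l)` sends `castSucc (last n)` (value `n`) to
`castSucc (last (n+1))` (value `n+1`). [folklore] -/
theorem hb_succAbove_castSucc_castSucc_apply {n : ℕ} (l : Fin (n + 1)) :
    (Fin.castSucc (Fin.castSucc l)).succAbove (Fin.castSucc (Fin.last n) : Fin (n + 2)) =
      Fin.castSucc (Fin.last (n + 1)) := by
  rw [Fin.succAbove_of_le_castSucc _ _ (Fin.le_def.mpr (by simp [Fin.is_le]))]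
  exact Fin.ext (by simp)

/-- **Second-to-last-row cofactors of a sparse-bordered matrix.**  For `B` of size `n+3` whose last row vanishes
left of column `n+1` and whose last column vanishes above row `n`, deleting row `n+1` and an old column `l` gives
`per B(n+1 | l) = B(last,last) · per B|(last | l) + B(last, n+1) · B(n, last) · per B||(last | l)`, where `B|`, `B||`
are the top-left blocks of sizes `n+2`, `n+1` (Laplace along the last row of the minor: the corner term, and the
single border term, whose minor has the last column forced onto row `n`). [Minc 1978 §1.2; folklore] -/
theorem hb_permanent_submatrix_secondRow_of_sparseBorder {S : Type*} [CommRing S] {n : ℕ}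
    (B : Matrix (Fin (n + 3)) (Fin (n + 3)) S)
    (hrow : ∀ j : Fin (n + 1), B (Fin.last (n + 2)) (Fin.castSucc (Fin.castSucc j)) = 0)
    (hcol : ∀ i : Fin n, B (Fin.castSucc (Fin.castSucc (Fin.castSucc i))) (Fin.last (n + 2)) = 0)
    (l : Fin (n + 1)) :
    (B.submatrix (Fin.castSucc (Fin.last (n + 1))).succAbove (Fin.castSucc (Fin.castSucc l)).succAbove).permanent =
      B (Fin.last (n + 2)) (Fin.last (n + 2)) *
          ((B.submatrix Fin.castSucc Fin.castSucc).submatrix (Fin.last (n + 1)).succAbove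
            (Fin.castSucc l).succAbove).permanent +
        B (Fin.last (n + 2)) (Fin.castSucc (Fin.last (n + 1))) *
          B (Fin.castSucc (Fin.castSucc (Fin.last n))) (Fin.last (n + 2)) *
          ((B.submatrix (Fin.castSucc ∘ Fin.castSucc) (Fin.castSucc ∘ Fin.castSucc)).submatrix
            (Fin.last n).succAbove l.succAbove).permanent := by
  classical
  -- `B₀` := `B` with the corner replaced by `0`
  set B₀ : Matrix (Fin (n + 3)) (Fin (n + 3)) S :=
    Matrix.of fun i j => if i = Fin.last (n + 2) ∧ j = Fin.last (n + 2) then 0 else B i j with hB₀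
  have hrows : ∀ i j, B₀ (Fin.castSucc i) j = B (Fin.castSucc i) j := by
    intro i j; simp [hB₀, (Fin.castSucc_lt_last i).ne]
  have hlast : ∀ j, B₀ (Fin.last (n + 2)) (Fin.castSucc j) = B (Fin.last (n + 2)) (Fin.castSucc j) := by
    intro j; simp [hB₀, (Fin.castSucc_lt_last j).ne]
  have h0 : B₀ (Fin.last (n + 2)) (Fin.last (n + 2)) = 0 := by simp [hB₀]
  rw [pb_permanent_submatrix_castSucc_castSucc B B₀ (B.submatrix Fin.castSucc Fin.castSucc) (fun i j => rfl)
    hrows hlast h0 (Fin.last (n + 1)) (Fin.castSucc l)]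
  congr 1
  -- the `B₀`-minor: expand along its last row, which has the single entry `B(last, n+1)` at column `castSucc (last n)`
  set M := B₀.submatrix (Fin.castSucc (Fin.last (n + 1))).succAbove (Fin.castSucc (Fin.castSucc l)).succAbove
    with hM
  have hMrow : ∀ c : Fin (n + 2), c ≠ Fin.castSucc (Fin.last n) → M (Fin.last (n + 1)) c = 0 := by
    intro c hc
    rw [hM, Matrix.submatrix_apply, pb_succAbove_castSucc_last]
    rcases Fin.eq_castSucc_or_eq_last c with ⟨c', rfl⟩ | rfl
    · rw [Fin.castSucc_succAbove_castSucc, hlast]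
      rcases Fin.eq_castSucc_or_eq_last c' with ⟨c'', rfl⟩ | rfl
      · rw [Fin.castSucc_succAbove_castSucc, hrow]
      · exact absurd rfl hc
    · rw [pb_succAbove_castSucc_last, h0]
  rw [Matrix.permanent_eq_sum_row_subset M (Fin.last (n + 1)) {Fin.castSucc (Fin.last n)}
    (fun c hc => hMrow c (by simpa using hc)), Finset.sum_singleton]
  -- the entry
  have hentry : M (Fin.last (n + 1)) (Fin.castSucc (Fin.last n)) = B (Fin.last (n + 2)) (Fin.castSucc (Fin.last (n + 1))) := by
    rw [hM, Matrix.submatrix_apply, pb_succAbove_castSucc_last, hb_succAbove_castSucc_castSucc_apply, hlast]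
  rw [hentry, mul_assoc]
  congr 1
  -- the inner minor: rows `0..n`, columns `[n+2] \\ {l, n+1}`; its last column (the border column) is forced onto row `n`
  set M' := M.submatrix (Fin.last (n + 1)).succAbove (Fin.castSucc (Fin.last n)).succAbove with hM'
  -- identify the entries of `M'`
  have hM'val : ∀ a b : Fin (n + 1), M' a b =
      B (Fin.castSucc (Fin.castSucc a)) ((Fin.castSucc (Fin.castSucc l)).succAbove
        ((Fin.castSucc (Fin.last n)).succAbove b)) := by
    intro a b
    rw [hM', Matrix.submatrix_apply, hM, Matrix.submatrix_apply, Fin.succAbove_last,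
      Fin.castSucc_succAbove_castSucc, Fin.succAbove_last, hrows]
  -- column bookkeeping: `b = last n` is the border column, `b = castSucc b'` are the old-old columns `l.succAbove b'`
  have hcolLast : (Fin.castSucc (Fin.castSucc l)).succAbove ((Fin.castSucc (Fin.last n)).succAbove (Fin.last n)) =
      Fin.last (n + 2) := by
    rw [pb_succAbove_castSucc_last, Fin.succAbove_of_le_castSucc _ _ (Fin.le_def.mpr (by simp)),
      Fin.succ_last]
  have hcolOld : ∀ b' : Fin n, (Fin.castSucc (Fin.castSucc l)).succAbove
      ((Fin.castSucc (Fin.last n)).succAbove (Fin.castSucc b')) = Fin.castSucc (Fin.castSucc (l.succAbove b')) := by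
    intro b'
    rw [Fin.castSucc_succAbove_castSucc, Fin.succAbove_last, Fin.castSucc_succAbove_castSucc,
      Fin.castSucc_succAbove_castSucc]
  -- expand `M'` along its last column
  rw [Matrix.permanent_eq_sum_column M' (Fin.last n), Fin.sum_univ_castSucc]
  have hvan : ∑ i : Fin n, M' (Fin.castSucc i) (Fin.last n) *
      (M'.submatrix (Fin.castSucc i).succAbove (Fin.last n).succAbove).permanent = 0 :=
    Finset.sum_eq_zero fun i _ => by rw [hM'val, hcolLast, hcol i, zero_mul]
  rw [hvan, zero_add, hM'val, hcolLast]
  congr 1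
  congr 1
  ext a b
  simp only [Matrix.submatrix_apply, hM'val, Fin.succAbove_last, hcolOld, Function.comp_apply]

/-- **Second-to-last-row generators, two-term recurrence** (pencil form, the `E0` completion): for `φ` of size
`n+3` whose last row vanishes left of column `n+1` and whose last column vanishes above row `n`,
`(∂_{n+1, l} per_{n+3})(φ) = φ(last,last) · (∂_{last, l} per_{n+2})(φ|) + φ(last, n+1) · φ(n, last) · (∂_{last, l} per_{n+1})(φ||)`;
for `HB_N`: `Per_{N-1,j} = a_N y₁ Per⁽ᴺ⁻¹⁾_{N-1,j} + c_N d_{N-2} y₀y₃ Per⁽ᴺ⁻²⁾_{N-2,j}`, whose `c_N`-slope is the subtle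
direction of the degeneration step. [Minc 1978 §1.2; folklore] -/
theorem hb_secondRow_generator_two_term {K A : Type*} [CommRing K] [CommRing A] [Algebra K A] {n : ℕ}
    (φ : Fin (n + 3) × Fin (n + 3) → A)
    (hrow : ∀ j : Fin (n + 1), φ (Fin.last (n + 2), Fin.castSucc (Fin.castSucc j)) = 0)
    (hcol : ∀ i : Fin n, φ (Fin.castSucc (Fin.castSucc (Fin.castSucc i)), Fin.last (n + 2)) = 0)
    (l : Fin (n + 1)) :
    MvPolynomial.aeval φ (MvPolynomial.pderiv (Fin.castSucc (Fin.last (n + 1)), Fin.castSucc (Fin.castSucc l))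
        (perPoly (Fin (n + 3)) K)) =
      φ (Fin.last (n + 2), Fin.last (n + 2)) *
          MvPolynomial.aeval (fun q : Fin (n + 2) × Fin (n + 2) => φ (Fin.castSucc q.1, Fin.castSucc q.2))
            (MvPolynomial.pderiv (Fin.last (n + 1), Fin.castSucc l) (perPoly (Fin (n + 2)) K)) +
        φ (Fin.last (n + 2), Fin.castSucc (Fin.last (n + 1))) *
          φ (Fin.castSucc (Fin.castSucc (Fin.last n)), Fin.last (n + 2)) *
          MvPolynomial.aeval (fun q : Fin (n + 1) × Fin (n + 1) =>
              φ (Fin.castSucc (Fin.castSucc q.1), Fin.castSucc (Fin.castSucc q.2)))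
            (MvPolynomial.pderiv (Fin.last n, l) (perPoly (Fin (n + 1)) K)) := by
  rw [pb_aeval_pderiv_perPoly, pb_aeval_pderiv_perPoly, pb_aeval_pderiv_perPoly]
  exact hb_permanent_submatrix_secondRow_of_sparseBorder (Matrix.of fun i j => φ (i, j)) hrow hcol l

end SecondRow

end Summit.ValiantsHypothesis.ValiantsHypothesis.Theorems.ValuativeFlip
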